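import Literature.Geometry.Lorentzian.CommonDevelopmentEmbedding
import Literature.Topology.FourManifolds.GluingConstruction
import HarnessLib

/-!
# Gluing a development of SUB-data into a development along a relative common development:
# the glued space, corresponding boundary points and the Hausdorff criterion
# (relative form of Sbierski 2016, Def. 11, §3.3)

Relative version of `DevelopmentGluingData`. There, two Cauchy developments `M`, `M'` of the SAME
data are glued along a common globally hyperbolic development `U ⊆ M` with its isometric
embedding `ψ : U → M'` (J. Sbierski, Ann. Henri Poincaré 17 (2016) = arXiv:1309.7591v3, §3.3;
Choquet-Bruhat–Geroch, Comm. Math. Phys. 14 (1969), pp. 333–334). The localisation principle of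
the Cauchy problem ("the maximal development of a sub-datum embeds into the maximal development
of the datum", Hawking–Ellis 1973, §7.5–7.6; Choquet-Bruhat–Geroch 1969, p. 334, domain of
dependence) rests on the same construction for DIFFERENT data: `𝒟₁ = (M₁, g₁, ι₁)` is a Cauchy
development of data `D₁` on `N`, `𝒟₂ = (M₂, g₂, ι₂)` one of data `D₂` on `X`, `Φ : N → X` (in
the application an open embedding with `D₁ = Φ^* D₂`), and the gluing is along a *relative common
development*: an open `U ⊆ M₁` containing `ι₁(N)` as a Cauchy hypersurface together with an
injective time-orientation preserving isometric immersion `ψ : U → M₂` **over `Φ`**,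
`ψ ∘ ι₁ = ι₂ ∘ Φ`. This file is the topological part, word for word as in the absolute case over
the general pushout of smooth manifolds (`Literature.Topology.FourManifolds.SmoothGlueData`):

* `CauchyDevelopment.RelCommonDevelopment 𝒟₁ 𝒟₂ Φ` — the datum `(U, ψ)` (injectivity of `ψ` is
  part of the datum: for an injective `Φ` it follows from the relative form of Sbierski's
  Lemma 3.2, proved on the summit side, and is supplied by the user);
* `RelCommonDevelopment.glue`, `glueData`, `Glued = (M₁ ⊔ M₂)/∼`, `inl = π ∘ j₁ : M₁ → Glued`,
  `inr = π ∘ j₂ : M₂ → Glued`, `inl_eq_inr_iff`, `inl_embed_eq_inr_embed : π j₁ ι₁ = π j₂ ι₂ Φ`;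
* `IsCorrespondingPair`, `HasCorrespondingBoundaryPoints` (Sbierski, Def. 11) and
  `isClosed_graph_iff_not_hasCorrespondingBoundaryPoints`, `t2Space_glued`,
  `not_hasCorrespondingBoundaryPoints_of_t2Space`;
* `secondCountableTopology_glued`, `connectedSpace_glued`.

No named facts are introduced (D-0026); `RelCommonDevelopment`, `glue`, `glueData` and the two
`Prop`-valued definitions of Def. 11 have bodies, everything else is proved (proofs transcribed
from `DevelopmentGluingData`).

## References

* J. Sbierski, Ann. Henri Poincaré 17 (2016) 301–329 = arXiv:1309.7591v3, §2 Def. 2.4, §3.2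
  Def. 11, §3.3 proof of Thm. 5.
* Y. Choquet-Bruhat, R. Geroch, Comm. Math. Phys. 14 (1969) 329–335, proof of Thm. 3, pp. 333–334.
* S. W. Hawking, G. F. R. Ellis, *The large scale structure of space-time*, CUP 1973, §7.5–7.6.
* A. Kosinski, *Differential Manifolds* (1993), VI.1 (gluing along a partial diffeomorphism).
-/

noncomputable section

open Bundle Set Function Filter TopologicalSpace Topology Manifold
open scoped Manifold ContDiff Topology
open Literature.Topology.FourManifolds

namespace Literature.Geometry.Lorentzian

universe u

section Developments

variable {n : ℕ} {N : Type u} [TopologicalSpace N] [ChartedSpace (EuclideanSpace ℝ (Fin n)) N]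
  [IsManifold (𝓡 n) ∞ N] [ConnectedSpace N] {D₁ : InitialDataSet (𝓡 n) N}
  {X : Type u} [TopologicalSpace X] [ChartedSpace (EuclideanSpace ℝ (Fin n)) X]
  [IsManifold (𝓡 n) ∞ X] [ConnectedSpace X] {D₂ : InitialDataSet (𝓡 n) X}

namespace CauchyDevelopment

/-- **A relative common globally hyperbolic development of `𝒟₁` and `𝒟₂` over `Φ`** (the datum
`(U, ψ)` of Sbierski 2016, Def. 2.4 and §3.3, for developments of different data): an open subset
`U` of the spacetime of the Cauchy development `𝒟₁ = (M₁, g₁, τ₁, ι₁, ν₁)` of data `D₁` on `N`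
containing the data hypersurface `ι₁(N)`, in which `ι₁(N)` is a Cauchy hypersurface (for `g₁|_U`,
`τ₁|_U`), and an injective time-orientation preserving isometric immersion
`ψ : (U, g₁|_U, τ₁|_U) → (M₂, g₂, τ₂)` into the spacetime of the Cauchy development `𝒟₂` of data
`D₂` on `X`, lying OVER the map `Φ : N → X` of data manifolds: `ψ ∘ ι₁ = ι₂ ∘ Φ`
(Hawking–Ellis 1973, §7.5, p. 249: the common part `𝓤''` of developments `(𝓜', θ')` of `𝓢'`
and `(𝓜'', θ'')` of `𝓢'' ⊆ 𝓢'`). For `D₁ = D₂`, `Φ = id` this is `CommonDevelopment`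
(`DevelopmentGluingData`), where injectivity is a theorem (Sbierski, Lemma 9).
[cite: Sbierski2016AHP, §2, Def. 2.4 (arXiv: Def. 4) and §3.3] -/
structure RelCommonDevelopment (𝒟₁ : CauchyDevelopment D₁) (𝒟₂ : CauchyDevelopment D₂)
    (Φ : N → X) where
  /-- The open subset `U ⊆ M₁`. -/
  opens : Opens 𝒟₁.carrier
  /-- `ι₁(N) ⊆ U`. -/
  embed_mem : ∀ x, 𝒟₁.embed x ∈ opens
  /-- `ι₁(N)` is a Cauchy hypersurface of `(U, g₁|_U, τ₁|_U)`. -/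
  isCauchyHypersurface :
    (𝒟₁.metric.restrict PseudoRiemannianMetric.contMDiff_restrict_holds opens).IsCauchyHypersurface
      (𝒟₁.timeOrientation.restrict PseudoRiemannianMetric.contMDiff_restrict_holds
        𝒟₁.timeOrientation.contMDiff_restrict_holds opens) (Subtype.val ⁻¹' range 𝒟₁.embed)
  /-- The map `ψ : U → M₂`. -/
  map : opens → 𝒟₂.carrier
  /-- `ψ` is an isometric immersion of `(U, g₁|_U)` into `(M₂, g₂)`. -/
  isIsometricImmersion :
    (𝒟₁.metric.restrict PseudoRiemannianMetric.contMDiff_restrict_holds opens).IsIsometricImmersion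
      𝒟₂.metric.toPseudoRiemannianMetric map
  /-- `ψ` preserves the time orientations. -/
  preservesTimeOrientation :
    (𝒟₁.timeOrientation.restrict PseudoRiemannianMetric.contMDiff_restrict_holds
      𝒟₁.timeOrientation.contMDiff_restrict_holds opens).PreservesTimeOrientation map
        𝒟₂.timeOrientation
  /-- `ψ` lies over `Φ`: `ψ ∘ ι₁ = ι₂ ∘ Φ`. -/
  map_comp_embedOpens : map ∘ 𝒟₁.embedOpens opens embed_mem = 𝒟₂.embed ∘ Φ
  /-- `ψ` is injective. -/
  injective_map : Injective map

namespace RelCommonDevelopment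

variable {𝒟₁ : CauchyDevelopment D₁} {𝒟₂ : CauchyDevelopment D₂} {Φ : N → X}
  (𝔠 : RelCommonDevelopment 𝒟₁ 𝒟₂ Φ)

/-- `ψ (ι₁ x) = ι₂ (Φ x)`. [cite: Sbierski2016AHP, §2, Def. 2.3–2.4 (arXiv: Def. 3–4)] -/
theorem map_embedOpens (x : N) :
    𝔠.map (𝒟₁.embedOpens 𝔠.opens 𝔠.embed_mem x) = 𝒟₂.embed (Φ x) :=
  congrFun 𝔠.map_comp_embedOpens x

/-- The open subset of a common development is nonempty (it contains `ι(X)`, `X ≠ ∅`). [folklore] -/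
instance nonempty_opens : Nonempty 𝔠.opens := by
  obtain ⟨x⟩ : Nonempty N := inferInstance
  exact ⟨𝒟₁.embedOpens 𝔠.opens 𝔠.embed_mem x⟩

/-- `ψ` is smooth. [cite: Sbierski2016AHP, §2, Def. 2.3 (arXiv: Def. 3)] -/
theorem contMDiff_map : ContMDiff (𝓡 (n + 1)) (𝓡 (n + 1)) ∞ 𝔠.map :=
  𝔠.isIsometricImmersion.1

/-- `ψ` is a local diffeomorphism (an isometric immersion between manifolds of the same
dimension). [cite: Sbierski2016AHP, §3.1, Lemma 9 (arXiv numbering)] -/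
theorem isLocalDiffeomorph_map : IsLocalDiffeomorph (𝓡 (n + 1)) (𝓡 (n + 1)) ∞ 𝔠.map :=
  LorentzianMetric.isLocalDiffeomorph_of_isIsometricImmersion 𝔠.isIsometricImmersion

/-- **`ψ` is an open embedding**: an injective local diffeomorphism.
[cite: Sbierski2016AHP, §3.1, Lemma 9 (arXiv numbering)] -/
theorem isOpenEmbedding_map : IsOpenEmbedding 𝔠.map :=
  𝔠.isLocalDiffeomorph_map.isLocalHomeomorph.isOpenEmbedding_of_injective 𝔠.injective_map

/-! ### The gluing map as an open partial homeomorphism `M ⇀ M'` -/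

/-- **The gluing map** `ψ` as an open partial homeomorphism `M ⇀ M'` with source `U` and target
`ψ(U)`: the inverse of the inclusion `U ↪ M` followed by the open embedding `ψ`.
[cite: Sbierski2016AHP, §3.3, proof of Thm. 5 (the identification `p ∼ ψ(p)`)] -/
def glue : OpenPartialHomeomorph 𝒟₁.carrier 𝒟₂.carrier :=
  (𝔠.opens.openPartialHomeomorphSubtypeCoe 𝔠.nonempty_opens).symm.trans
    (𝔠.isOpenEmbedding_map.toOpenPartialHomeomorph 𝔠.map)

/-- The source of the gluing map is `U`. [folklore] -/
@[simp]
theorem glue_source : 𝔠.glue.source = (𝔠.opens : Set 𝒟₁.carrier) := by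
  simp [glue]

/-- The target of the gluing map is `ψ(U)`. [folklore] -/
@[simp]
theorem glue_target : 𝔠.glue.target = range 𝔠.map := by
  simp [glue]

/-- The inverse of the inclusion `U ↪ M` at a point of `U`. [folklore] -/
theorem subtypeCoe_symm_apply {p : 𝒟₁.carrier} (hp : p ∈ 𝔠.opens) :
    (𝔠.opens.openPartialHomeomorphSubtypeCoe 𝔠.nonempty_opens).symm p = ⟨p, hp⟩ := by
  have h := (𝔠.opens.openPartialHomeomorphSubtypeCoe 𝔠.nonempty_opens).left_inv
    (x := ⟨p, hp⟩) (by simp)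
  simpa using h

/-- **On `U` the gluing map is `ψ`**: `glue p = ψ ⟨p, _⟩`. [folklore] -/
theorem glue_apply {p : 𝒟₁.carrier} (hp : p ∈ 𝔠.opens) : 𝔠.glue p = 𝔠.map ⟨p, hp⟩ := by
  simp [glue, 𝔠.subtypeCoe_symm_apply hp]

/-- `glue ∘ Subtype.val = ψ` on `U`. [folklore] -/
theorem glue_comp_subtypeVal : 𝔠.glue ∘ (Subtype.val : 𝔠.opens → 𝒟₁.carrier) = 𝔠.map :=
  funext fun y ↦ 𝔠.glue_apply y.2

/-- The inverse gluing map on `ψ(U)`: `glue.symm (ψ y) = y`. [folklore] -/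
theorem glue_symm_apply_map (y : 𝔠.opens) : 𝔠.glue.symm (𝔠.map y) = y := by
  have h : 𝔠.glue y = 𝔠.map y := 𝔠.glue_apply y.2
  rw [← h]
  exact 𝔠.glue.left_inv (by simp)

/-- **The gluing map is smooth on `U`.** [cite: Sbierski2016AHP, §3.3, proof of Thm. 5 ("smooth diffeomorphisms")] -/
theorem contMDiffOn_glue : ContMDiffOn (𝓡 (n + 1)) (𝓡 (n + 1)) ∞ 𝔠.glue 𝔠.glue.source := by
  rw [glue_source]
  intro p hp
  have h : ContMDiffAt (𝓡 (n + 1)) (𝓡 (n + 1)) ∞ (fun y : 𝔠.opens ↦ 𝔠.glue y) ⟨p, hp⟩ := by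
    have heq : (fun y : 𝔠.opens ↦ 𝔠.glue y) = 𝔠.map := 𝔠.glue_comp_subtypeVal
    rw [heq]
    exact 𝔠.contMDiff_map ⟨p, hp⟩
  exact (contMDiffAt_subtype_iff.mp h).contMDiffWithinAt

/-- The gluing map is differentiable at the points of `U`, with the differential of `ψ`.
[folklore] -/
theorem mfderiv_glue_eq (y : 𝔠.opens) :
    mfderiv (𝓡 (n + 1)) (𝓡 (n + 1)) 𝔠.glue y.1 = mfderiv (𝓡 (n + 1)) (𝓡 (n + 1)) 𝔠.map y := by
  have hd : MDifferentiableAt (𝓡 (n + 1)) (𝓡 (n + 1)) 𝔠.glue y.1 :=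
    (𝔠.contMDiffOn_glue.contMDiffAt (by
      rw [glue_source]; exact 𝔠.opens.2.mem_nhds y.2)).mdifferentiableAt (by simp)
  rw [← mfderiv_comp_subtypeVal (I' := 𝓡 (n + 1)) (I := 𝓡 (n + 1)) (W := 𝔠.opens) hd,
    glue_comp_subtypeVal]

/-- **The inverse gluing map is smooth on `ψ(U)`**: near `ψ y` it is the inclusion composed with
a local inverse of the local diffeomorphism `ψ`. [cite: Sbierski2016AHP, §3.3, proof of Thm. 5 ("smooth diffeomorphisms")] -/
theorem contMDiffOn_glue_symm :
    ContMDiffOn (𝓡 (n + 1)) (𝓡 (n + 1)) ∞ 𝔠.glue.symm 𝔠.glue.target := by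
  rw [glue_target]
  rintro _ ⟨y, rfl⟩
  obtain ⟨Φ, hyΦ, heq⟩ := 𝔠.isLocalDiffeomorph_map y
  -- near `ψ y`, `glue.symm = Subtype.val ∘ Φ.symm`
  have htgt : IsOpen Φ.target := Φ.open_target
  have hyt : 𝔠.map y ∈ Φ.target := by rw [heq hyΦ]; exact Φ.map_source hyΦ
  have hev : 𝔠.glue.symm =ᶠ[𝓝 (𝔠.map y)] (Subtype.val ∘ Φ.symm) := by
    filter_upwards [htgt.mem_nhds hyt] with z hz
    have hw : Φ.symm z ∈ Φ.source := Φ.map_target hz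
    have hz' : z = 𝔠.map (Φ.symm z) := by rw [heq hw]; exact (Φ.right_inv hz).symm
    rw [comp_apply, hz', 𝔠.glue_symm_apply_map]
    exact congrArg Subtype.val (by rw [← hz'])
  have hsm : ContMDiffAt (𝓡 (n + 1)) (𝓡 (n + 1)) ∞ (Subtype.val ∘ Φ.symm) (𝔠.map y) :=
    (contMDiff_subtype_val.contMDiffAt).comp _
      ((Φ.contMDiffOn_invFun.contMDiffAt (htgt.mem_nhds hyt)))
  exact (hsm.congr_of_eventuallyEq hev).contMDiffWithinAt

/-- **The gluing datum** of a common development: `M` and `M'` glued along the partial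
diffeomorphism `ψ : U ≅ ψ(U)` (`Literature.Topology.FourManifolds.SmoothGlueData`, model
`ℝ^{n+1}` on both sides). [cite: Sbierski2016AHP, §3.3, proof of Thm. 5] -/
def glueData : SmoothGlueData (𝓡 (n + 1)) (𝓡 (n + 1)) 𝒟₁.carrier 𝒟₂.carrier
    (EuclideanSpace ℝ (Fin (n + 1))) where
  glue := 𝔠.glue
  contMDiffOn_glue := 𝔠.contMDiffOn_glue
  contMDiffOn_glue_symm := 𝔠.contMDiffOn_glue_symm
  linA := ContinuousLinearEquiv.refl ℝ _
  linB := ContinuousLinearEquiv.refl ℝ _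

/-- The gluing map of the gluing datum is `glue`. [folklore] -/
@[simp]
theorem glueData_glue : 𝔠.glueData.glue = 𝔠.glue := rfl

/-- **The glued space** `M̃ = (M ⊔ M')/∼`, `p ∼ ψ(p)` for `p ∈ U`, with the quotient topology and
its smooth structure (`SmoothGlueData.Glued`). [cite: Sbierski2016AHP, §3.3, proof of Thm. 5] -/
abbrev Glued : Type u := 𝔠.glueData.Glued

/-- The first piece `π ∘ j : M → M̃`. [cite: Sbierski2016AHP, §3.3, proof of Thm. 5] -/
abbrev inl : 𝒟₁.carrier → 𝔠.Glued := 𝔠.glueData.inl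

/-- The second piece `π ∘ j' : M' → M̃`. [cite: Sbierski2016AHP, §3.3, proof of Thm. 5] -/
abbrev inr : 𝒟₂.carrier → 𝔠.Glued := 𝔠.glueData.inr

/-- **The identification**: `π j p = π j' p'` iff `p ∈ U` and `p' = ψ p`.
[cite: Sbierski2016AHP, §3.3, proof of Thm. 5] -/
theorem inl_eq_inr_iff {p : 𝒟₁.carrier} {p' : 𝒟₂.carrier} :
    𝔠.inl p = 𝔠.inr p' ↔ ∃ hp : p ∈ 𝔠.opens, 𝔠.map ⟨p, hp⟩ = p' := by
  rw [inl, inr, 𝔠.glueData.inl_eq_inr_iff, glueData_glue]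
  constructor
  · rintro ⟨hp, h⟩
    rw [glue_source] at hp
    exact ⟨hp, by rw [← 𝔠.glue_apply hp]; exact h⟩
  · rintro ⟨hp, h⟩
    refine ⟨by rw [glue_source]; exact hp, ?_⟩
    rw [𝔠.glue_apply hp]
    exact h

/-- `π j' (ψ y) = π j y`. [cite: Sbierski2016AHP, §3.3, proof of Thm. 5] -/
theorem inr_map (y : 𝔠.opens) : 𝔠.inr (𝔠.map y) = 𝔠.inl y :=
  (𝔠.inl_eq_inr_iff.2 ⟨y.2, rfl⟩).symm

/-- **The two data embeddings agree in the glued space over `Φ`**: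
`π j₁ (ι₁ x) = π j₂ (ι₂ (Φ x))` (`ι₁(N) ⊆ U` and `ψ ∘ ι₁ = ι₂ ∘ Φ`). [cite: Sbierski2016AHP, §3.3, proof of Thm. 5 (`ι̃ := π ∘ j ∘ ι`)] -/
theorem inl_embed_eq_inr_embed (x : N) : 𝔠.inl (𝒟₁.embed x) = 𝔠.inr (𝒟₂.embed (Φ x)) :=
  𝔠.inl_eq_inr_iff.2 ⟨𝔠.embed_mem x, 𝔠.map_embedOpens x⟩

/-! ### Corresponding boundary points (Sbierski 2016, Def. 11) and the Hausdorff property -/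

/-- **Corresponding boundary points** (Sbierski 2016, Def. 11): `p ∈ ∂U ⊆ M` and
`p' ∈ ∂ψ(U) ⊆ M'` *correspond* if for all neighbourhoods `V` of `p` and `V'` of `p'` one has
`ψ⁻¹(V' ∩ ψ(U)) ∩ V ≠ ∅`, i.e. some point of `U` in `V` is mapped into `V'`.
[cite: Sbierski2016AHP, §3.2, Def. 11 (arXiv numbering)] -/
def IsCorrespondingPair (p : 𝒟₁.carrier) (p' : 𝒟₂.carrier) : Prop :=
  p ∈ frontier (𝔠.opens : Set 𝒟₁.carrier) ∧ p' ∈ frontier (range 𝔠.map) ∧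
    ∀ V ∈ 𝓝 p, ∀ V' ∈ 𝓝 p', ∃ y : 𝔠.opens, (y : 𝒟₁.carrier) ∈ V ∧ 𝔠.map y ∈ V'

/-- `U` **has corresponding boundary points** (in `M` and `M'`): some pair of boundary points
corresponds (the set `C` of Sbierski 2016, §3.2, is nonempty). [cite: Sbierski2016AHP, §3.2, Def. 11 and Thm. 12 (arXiv numbering)] -/
def HasCorrespondingBoundaryPoints (𝔠 : RelCommonDevelopment 𝒟₁ 𝒟₂ Φ) : Prop :=
  ∃ p p', 𝔠.IsCorrespondingPair p p'

/-- The graph of the gluing map `{(p, ψ p) | p ∈ U} ⊆ M × M'`. [folklore] -/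
theorem mem_graph_iff {q : 𝒟₁.carrier × 𝒟₂.carrier} :
    q ∈ {q : 𝒟₁.carrier × 𝒟₂.carrier | q.1 ∈ 𝔠.glue.source ∧ 𝔠.glue q.1 = q.2} ↔
      ∃ hp : q.1 ∈ 𝔠.opens, 𝔠.map ⟨q.1, hp⟩ = q.2 := by
  simp only [mem_setOf_eq, glue_source, SetLike.mem_coe]
  constructor
  · rintro ⟨hp, h⟩
    exact ⟨hp, by rw [← 𝔠.glue_apply hp]; exact h⟩
  · rintro ⟨hp, h⟩
    exact ⟨hp, by rw [𝔠.glue_apply hp]; exact h⟩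

/-- A pair in the closure of the graph of `ψ` satisfies the neighbourhood condition of Def. 11.
[folklore] -/
theorem forall_nhds_of_mem_closure_graph {p : 𝒟₁.carrier} {p' : 𝒟₂.carrier}
    (h : (p, p') ∈ closure {q : 𝒟₁.carrier × 𝒟₂.carrier | q.1 ∈ 𝔠.glue.source ∧ 𝔠.glue q.1 = q.2}) :
    ∀ V ∈ 𝓝 p, ∀ V' ∈ 𝓝 p', ∃ y : 𝔠.opens, (y : 𝒟₁.carrier) ∈ V ∧ 𝔠.map y ∈ V' := by
  intro V hV V' hV'
  rw [mem_closure_iff_nhds] at h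
  obtain ⟨⟨a, b⟩, hab, hgr⟩ := h (V ×ˢ V') (prod_mem_nhds hV hV')
  obtain ⟨ha, hmap⟩ := 𝔠.mem_graph_iff.1 hgr
  exact ⟨⟨a, ha⟩, hab.1, by rw [hmap]; exact hab.2⟩

/-- Conversely, the neighbourhood condition of Def. 11 puts the pair in the closure of the graph.
[folklore] -/
theorem mem_closure_graph_of_forall_nhds {p : 𝒟₁.carrier} {p' : 𝒟₂.carrier}
    (h : ∀ V ∈ 𝓝 p, ∀ V' ∈ 𝓝 p', ∃ y : 𝔠.opens, (y : 𝒟₁.carrier) ∈ V ∧ 𝔠.map y ∈ V') :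
    (p, p') ∈ closure {q : 𝒟₁.carrier × 𝒟₂.carrier | q.1 ∈ 𝔠.glue.source ∧ 𝔠.glue q.1 = q.2} := by
  rw [mem_closure_iff_nhds]
  intro W hW
  obtain ⟨V, hV, V', hV', hsub⟩ := mem_nhds_prod_iff.1 hW
  obtain ⟨y, hyV, hyV'⟩ := h V hV V' hV'
  exact ⟨(y.1, 𝔠.map y), hsub (mk_mem_prod hyV hyV'), 𝔠.mem_graph_iff.2 ⟨y.2, rfl⟩⟩

/-- **The closure of the graph of `ψ` consists of the graph and the corresponding pairs**: a
pair in the closure but not in the graph is a pair of corresponding boundary points. Indeed if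
`p ∈ U` then `p' = ψ p` by continuity of `ψ` at `p` (so the pair is in the graph), hence
`p ∈ Ū ∖ U = ∂U`; symmetrically `p' ∈ ∂ψ(U)` by continuity of `ψ⁻¹` on the open set `ψ(U)`.
[cite: Sbierski2016AHP, §3.2, Def. 11 and §3.3, proof of Thm. 5 (Hausdorff step)] -/
theorem isCorrespondingPair_of_mem_closure_graph {p : 𝒟₁.carrier} {p' : 𝒟₂.carrier}
    (h : (p, p') ∈ closure {q : 𝒟₁.carrier × 𝒟₂.carrier | q.1 ∈ 𝔠.glue.source ∧ 𝔠.glue q.1 = q.2})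
    (hn : (p, p') ∉ {q : 𝒟₁.carrier × 𝒟₂.carrier | q.1 ∈ 𝔠.glue.source ∧ 𝔠.glue q.1 = q.2}) :
    𝔠.IsCorrespondingPair p p' := by
  have hN := 𝔠.forall_nhds_of_mem_closure_graph h
  refine ⟨⟨?_, ?_⟩, ⟨?_, ?_⟩, hN⟩
  · -- `p ∈ closure U`
    rw [mem_closure_iff_nhds]
    intro V hV
    obtain ⟨y, hyV, -⟩ := hN V hV univ univ_mem
    exact ⟨y.1, hyV, y.2⟩
  · -- `p ∉ interior U = U`: otherwise `p' = ψ p` by continuity of `ψ` at `p`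
    rw [𝔠.opens.isOpen.interior_eq]
    intro hp
    apply hn
    refine (𝔠.mem_graph_iff (q := (p, p'))).2 ⟨hp, ?_⟩
    by_contra hne
    obtain ⟨W, W', hWo, hW'o, hW, hW', hdisj⟩ := t2_separation hne
    have hc : ContinuousAt 𝔠.glue p := 𝔠.glue.continuousAt (by rw [glue_source]; exact hp)
    have hV : 𝔠.glue ⁻¹' W ∈ 𝓝 p :=
      hc.preimage_mem_nhds (hWo.mem_nhds (by rw [𝔠.glue_apply hp]; exact hW))
    obtain ⟨y, hyV, hyW'⟩ := hN _ hV W' (hW'o.mem_nhds hW')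
    have hyW : 𝔠.map y ∈ W := by
      have h' : 𝔠.glue y ∈ W := hyV
      rwa [𝔠.glue_apply y.2] at h'
    exact Set.disjoint_left.1 hdisj hyW hyW'
  · -- `p' ∈ closure ψ(U)`
    rw [mem_closure_iff_nhds]
    intro V' hV'
    obtain ⟨y, -, hyV'⟩ := hN univ univ_mem V' hV'
    exact ⟨𝔠.map y, hyV', y, rfl⟩
  · -- `p' ∉ interior ψ(U) = ψ(U)`: otherwise `p = ψ⁻¹ p'` by continuity of `ψ⁻¹` on `ψ(U)`
    rw [𝔠.isOpenEmbedding_map.isOpen_range.interior_eq]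
    rintro ⟨y₀, rfl⟩
    apply hn
    suffices hpy : p = y₀.1 by
      subst hpy
      exact (𝔠.mem_graph_iff (q := ((y₀ : 𝒟₁.carrier), 𝔠.map y₀))).2 ⟨y₀.2, rfl⟩
    by_contra hne
    obtain ⟨W, W₀, hWo, hW₀o, hW, hW₀, hdisj⟩ := t2_separation hne
    have hO : IsOpen (𝔠.map '' (Subtype.val ⁻¹' W₀)) :=
      𝔠.isOpenEmbedding_map.isOpenMap _ (hW₀o.preimage continuous_subtype_val)
    obtain ⟨y, hyW, y', hy'W₀, hyy'⟩ := hN W (hWo.mem_nhds hW) _ (hO.mem_nhds ⟨y₀, hW₀, rfl⟩)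
    have hyy : y' = y := 𝔠.injective_map hyy'
    subst hyy
    exact Set.disjoint_left.1 hdisj hyW hy'W₀

/-- **The graph of `ψ` is closed in `M × M'` iff `U` has no corresponding boundary points**
(the content of *"this is exactly the statement that there are no corresponding boundary
points"*, Sbierski 2016, §3.3): a corresponding pair lies in the closure of the graph but not in
the graph (`p ∈ ∂U` is not in the open `U`); conversely a point of the closure outside the graph
is a corresponding pair (`isCorrespondingPair_of_mem_closure_graph`).
[cite: Sbierski2016AHP, §3.3, proof of Thm. 5 (Hausdorff step) with §3.2, Def. 11] -/
theorem isClosed_graph_iff_not_hasCorrespondingBoundaryPoints :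
    IsClosed {q : 𝒟₁.carrier × 𝒟₂.carrier | q.1 ∈ 𝔠.glue.source ∧ 𝔠.glue q.1 = q.2} ↔
      ¬ 𝔠.HasCorrespondingBoundaryPoints := by
  constructor
  · rintro hcl ⟨p, p', hfr, -, hN⟩
    have hmem : (p, p') ∈ {q : 𝒟₁.carrier × 𝒟₂.carrier | q.1 ∈ 𝔠.glue.source ∧ 𝔠.glue q.1 = q.2} :=
      hcl.closure_subset (𝔠.mem_closure_graph_of_forall_nhds hN)
    obtain ⟨hp, -⟩ := 𝔠.mem_graph_iff.1 hmem
    have hp' : p ∉ interior (𝔠.opens : Set 𝒟₁.carrier) := hfr.2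
    rw [𝔠.opens.isOpen.interior_eq] at hp'
    exact hp' hp
  · intro h
    refine isClosed_of_closure_subset fun q hq ↦ ?_
    by_contra hqn
    obtain ⟨p, p'⟩ := q
    exact h ⟨p, p', 𝔠.isCorrespondingPair_of_mem_closure_graph hq hqn⟩

/-- **The glued space is Hausdorff if `U` has no corresponding boundary points** (Sbierski 2016,
§3.3: *"So suppose we could not separate these two points … `p` and `q` are corresponding
boundary points of `U`"*; here through the closed-graph criterion
`SmoothGlueData.t2Space_of_isClosed_graph`). [cite: Sbierski2016AHP, §3.3, proof of Thm. 5 ("`M̃` is indeed Hausdorff")] -/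
theorem t2Space_glued (h : ¬ 𝔠.HasCorrespondingBoundaryPoints) : T2Space 𝔠.Glued :=
  𝔠.glueData.t2Space_of_isClosed_graph
    (𝔠.isClosed_graph_iff_not_hasCorrespondingBoundaryPoints.2 h)

/-- **Conversely, corresponding boundary points obstruct the Hausdorff property**: if the glued
space is Hausdorff, `U` has no corresponding boundary points (a corresponding pair `p`, `p'`
gives two distinct points `π j p ≠ π j' p'` all of whose neighbourhoods meet). Sbierski 2016,
§3.3 (the Hausdorff property of `M̃` "is exactly the statement that there are no corresponding
boundary points"). [cite: Sbierski2016AHP, §3.3, proof of Thm. 5 (Hausdorff step)] -/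
theorem not_hasCorrespondingBoundaryPoints_of_t2Space [T2Space 𝔠.Glued] :
    ¬ 𝔠.HasCorrespondingBoundaryPoints := by
  rintro ⟨p, p', hfr, -, hN⟩
  have hp : p ∉ (𝔠.opens : Set 𝒟₁.carrier) := by
    have hp' : p ∉ interior (𝔠.opens : Set 𝒟₁.carrier) := hfr.2
    rwa [𝔠.opens.isOpen.interior_eq] at hp'
  have hne : 𝔠.inl p ≠ 𝔠.inr p' := fun h ↦ by
    obtain ⟨hpU, -⟩ := 𝔠.inl_eq_inr_iff.1 h
    exact hp hpU
  obtain ⟨A, B, hAo, hBo, hA, hB, hdisj⟩ := t2_separation hne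
  obtain ⟨y, hyA, hyB⟩ := hN _ (𝔠.glueData.continuous_inl.continuousAt.preimage_mem_nhds
    (hAo.mem_nhds hA)) _ (𝔠.glueData.continuous_inr.continuousAt.preimage_mem_nhds (hBo.mem_nhds hB))
  have h1 : 𝔠.inl y ∈ A := hyA
  have h2 : 𝔠.inl y ∈ B := by rw [← 𝔠.inr_map y]; exact hyB
  exact Set.disjoint_left.1 hdisj h1 h2

/-! ### Second countability and connectedness of the glued space -/

/-- The quotient map `M ⊔ M' → M̃` is open (saturations of open sets are open, `inl`, `inr` being
open maps). [folklore] -/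
theorem isOpenMap_proj : IsOpenMap 𝔠.glueData.proj := by
  intro s hs
  have heq : 𝔠.glueData.proj '' s =
      𝔠.inl '' (Sum.inl ⁻¹' s) ∪ 𝔠.inr '' (Sum.inr ⁻¹' s) := by
    ext q
    constructor
    · rintro ⟨x | x, hx, rfl⟩
      · exact Or.inl ⟨x, hx, rfl⟩
      · exact Or.inr ⟨x, hx, rfl⟩
    · rintro (⟨a, ha, rfl⟩ | ⟨b, hb, rfl⟩)
      · exact ⟨Sum.inl a, ha, rfl⟩
      · exact ⟨Sum.inr b, hb, rfl⟩
  rw [heq]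
  obtain ⟨h₁, h₂⟩ := isOpen_sum_iff.1 hs
  exact (𝔠.glueData.isOpenMap_inl _ h₁).union (𝔠.glueData.isOpenMap_inr _ h₂)

/-- **The glued space is second countable** (an open quotient of the second countable
`M ⊔ M'`; Sbierski 2016, §3.3: "`M̃` is second countable: This follows directly from the
previous construction"). [cite: Sbierski2016AHP, §3.3, proof of Thm. 5 ("`M̃` is second countable")] -/
instance secondCountableTopology_glued : SecondCountableTopology 𝔠.Glued :=
  𝔠.glueData.isQuotientMap_proj.secondCountableTopology 𝔠.isOpenMap_proj

/-- **The glued space is connected**: it is the union of the connected images of `M` and `M'`,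
which meet (at the image of the data hypersurface). [cite: Sbierski2016AHP, §3.3, proof of Thm. 5] -/
instance connectedSpace_glued : ConnectedSpace 𝔠.Glued := by
  obtain ⟨x⟩ : Nonempty N := inferInstance
  rw [connectedSpace_iff_univ, ← 𝔠.glueData.range_inl_union_range_inr]
  refine (isConnected_range 𝔠.glueData.continuous_inl).union ⟨𝔠.inl (𝒟₁.embed x), ⟨_, rfl⟩, ?_⟩
    (isConnected_range 𝔠.glueData.continuous_inr)
  exact ⟨𝒟₂.embed (Φ x), (𝔠.inl_embed_eq_inr_embed x).symm⟩

end RelCommonDevelopment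

end CauchyDevelopment

end Developments

end Literature.Geometry.Lorentzian

end
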